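import Mathlib
import HarnessLib
import Literature.MathematicalPhysics.QuantumLattice.HubbardEffectiveActionCTTranslation
import Summits.HubbardSuperconductivity.HubbardSuperconductivity.Theorems.KLProgrammeKLRegimeEngineTwoLegCellReader
import Summits.HubbardSuperconductivity.HubbardSuperconductivity.Theorems.KLProgrammeKLRegimeSectorSliceCharSumMoment

/-!
# Route `KLProgramme` — crux K3 ENGINE (stmt-HubbardSuperconductivity-20437 `KLRegimeEngineV17F2`), row (b), E1 docket item (2) «(E2)-CELL-READER», part 4:
# THE READER AT THE ENGINE'S OBJECT `𝒱_i[K]` — the structural hypotheses DISCHARGED; (E2) ⇐ order-three data of the ACTUAL two-leg symbol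

Cell `gate-hubbard-kl`, seat hubbard-kl-k3c2-p3 (g19).  Sequel of `…EngineTwoLegCellReader` (part 2, generic `T`) and of the Literature twin
`HubbardEffectiveActionCTTranslation` (space-time translations as frequency–momentum charge scalings; selection rules).  For the engine's own object
`T = 𝒱_i[K] = klEffectiveAction L M β U μ K klE0 i = hubbardEffectiveActionCT … 0 K Λ_i` the two hypotheses of the generic reader are TREE THEOREMS:

* §1 `kernel_klEffectiveAction_two_eq_zero_of_anomalous` — the anomalous strings `c₀ = c₁` vanish (the `U(1)` selection rule
  `kernel_hubbardEffectiveActionCT_eq_zero_of_spinCharge`); `kernel_klEffectiveAction_two_eq_ite_bar` — on every label string the `2`-kernel is conserving-diagonal through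
  the torus images, `kernel 𝒱_i 2 ((k_j,σ_j),c_j) = [k̄₀ = k̄₁]·g_τ(k̄₀)` with the CANONICAL symbol `g_τ(Q) := kernel 𝒱_i 2 ((Q̃,σ_j),c_j)_j` (the diagonal values;
  `kernel_hubbardEffectiveActionCT_two_eq_ite` + the round trip `freqMomentum_of_bar`);
* §2 **`klWtPinnedSumOf_two_klEffectiveAction_le`** — with NO structural hypothesis: for every frame `K`, scales `i, J`, pin `(q, w)`,
  `klWtPinnedSumOf L M β μ K J 2 (𝒱_i[K]) q w ≤ ε_x·Σ_{ℓ′} Σ_z w_J(z)·‖Σ_Q χ̄_Q(z)•(F_{J,ω}(Q̃)·F_{J,ω′}(Q̃)·Ŵ₂^{τ(q)}(Q̃))‖`, `Ŵ₂^{τ}(Q̃)` the diagonal two-leg kernel value of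
  `𝒱_i[K]` on the string `τ`; and **`klWtPinnedSumOf_two_klEffectiveAction_le_of_symbolData`** — the (E2) cell `≤ ε_x·Σ_{ℓ′} √(…)·√(21·2M·L²·N_s(ℓ′))·A₀(ℓ′)` from, per
  partner label, the support count of `F_{J,ω}F_{J,ω′}`, the sup of the pair symbol and its third single-direction differences in the five directions at the forced weight rates
  `s₀ = Λ_Jβ/(2M)`, `s₁ = Λ_J` (p3's `sliceCharSumWt_l1_le_of_data`, `c₀ = 1`).
THE E1-FACING FACE OF (E2), of record after this file: «sup and three scaled single-direction differences of the diagonal two-leg kernel `Ŵ₂(k₀,k⃗)` of `𝒱_i[K_n]` on the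
`3`-neighbourhoods of the partner supports of `F_{i−1}`, in the sector frame» (BGM 2006 (2.36)-shape data) — nothing about the STRUCTURE of the kernel is assumed any more.

Everything is proved; no definitions, no named facts; nothing here asserts (E2), any engine row, K3 or superconductivity. [folklore]
References: BGM 2006 §2.1 (symmetries), §2.3 (2.17), §2.7 (2.70), §2.8 (2.76), (2.81), (2.36) [cite: BenfattoGiulianiMastropietro2006].
-/

noncomputable section

namespace Summit.HubbardSuperconductivity.HubbardSuperconductivity.Theorems.TorusFourierL2

set_option linter.dupNamespace false -- summit = problem name (single-conjunct summit), D-0017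

open Finset Complex Literature.Probability.LatticeModels Literature.MathematicalPhysics.QuantumLattice
open Literature.MathematicalPhysics.QuantumLattice.GrassmannAlgebra
open Summit.HubbardSuperconductivity.HubbardSuperconductivity.Theorems.KLRegimeSplit
open Summit.HubbardSuperconductivity.HubbardSuperconductivity.Theorems.KLProgrammeLegKernels
open Summit.HubbardSuperconductivity.HubbardSuperconductivity.Theorems.EngineV8
open scoped Real ComplexConjugate

variable {L M : ℕ} [NeZero L] [NeZero M]

/-! ### §1 The structural hypotheses of the reader are theorems for `𝒱_i[K]` -/

omit [NeZero M] in
/-- **Anomalous two-leg strings of `𝒱_i[K]` vanish**: `kernel 𝒱_i 2 ((k₀,σ₀,c),(k₁,σ₁,c)) = 0` (the spin `σ₀` carries one or two `ψ^c` legs and no `ψ^{c̄}` leg: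
`kernel_hubbardEffectiveActionCT_eq_zero_of_spinCharge`). [cite: BenfattoGiulianiMastropietro2006, §2.3] -/
theorem kernel_klEffectiveAction_two_eq_zero_of_anomalous (β U μ : ℝ) (K : TrigPolyC4v) (i : ℕ) (τ : Fin 2 → Fin 2 × Fin 2)
    (hc : (τ 0).2 = (τ 1).2) (k : Fin 2 → FreqMomentum L M) :
    kernel ℂ (klEffectiveAction L M β U μ K klE0 i) 2 (fun j => ((k j, (τ j).1), (τ j).2)) = 0 := by
  have h := kernel_hubbardEffectiveActionCT_two_eq_ite L M β U μ K (klScale klE0 i) τ k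
  have h' := kernel_hubbardEffectiveActionCT_two_eq_ite L M β U μ K (klScale klE0 i) τ (fun _ => k 0)
  -- on the diagonal the anomalous string vanishes by the `U(1)` rule; off the diagonal by conservation
  unfold klEffectiveAction
  by_cases hk : k 0 = k 1
  · refine kernel_hubbardEffectiveActionCT_eq_zero_of_spinCharge L M β U μ K (klScale klE0 i) _ (τ 0).1 ?_
    classical
    obtain h0 | h0 : (τ 0).2 = 0 ∨ (τ 0).2 = 1 := Fin.exists_fin_two.mp ⟨(τ 0).2, rfl⟩
    · have h1 : (τ 1).2 = 0 := hc ▸ h0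
      have hempty : (Finset.univ.filter fun j : Fin 2 => ((fun j => (((k j, (τ j).1), (τ j).2) : HubbardFieldIdx L M)) j).1.2 = (τ 0).1 ∧
          ((fun j => (((k j, (τ j).1), (τ j).2) : HubbardFieldIdx L M)) j).2 = 1) = ∅ := by
        refine Finset.filter_eq_empty_iff.mpr fun j _ => ?_
        fin_cases j <;> simp [h0, h1]
      have hpos : (Finset.univ.filter fun j : Fin 2 => ((fun j => (((k j, (τ j).1), (τ j).2) : HubbardFieldIdx L M)) j).1.2 = (τ 0).1 ∧
          ((fun j => (((k j, (τ j).1), (τ j).2) : HubbardFieldIdx L M)) j).2 = 0).card ≠ 0 :=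
        Finset.card_ne_zero.mpr ⟨0, by simp [h0]⟩
      rw [hempty, Finset.card_empty]; exact hpos
    · have h1 : (τ 1).2 = 1 := hc ▸ h0
      have hempty : (Finset.univ.filter fun j : Fin 2 => ((fun j => (((k j, (τ j).1), (τ j).2) : HubbardFieldIdx L M)) j).1.2 = (τ 0).1 ∧
          ((fun j => (((k j, (τ j).1), (τ j).2) : HubbardFieldIdx L M)) j).2 = 0) = ∅ := by
        refine Finset.filter_eq_empty_iff.mpr fun j _ => ?_
        fin_cases j <;> simp [h0, h1]
      have hpos : (Finset.univ.filter fun j : Fin 2 => ((fun j => (((k j, (τ j).1), (τ j).2) : HubbardFieldIdx L M)) j).1.2 = (τ 0).1 ∧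
          ((fun j => (((k j, (τ j).1), (τ j).2) : HubbardFieldIdx L M)) j).2 = 1).card ≠ 0 :=
        Finset.card_ne_zero.mpr ⟨0, by simp [h0]⟩
      rw [hempty, Finset.card_empty]; exact hpos.symm
  · rw [h, if_neg hk]

/-- **The `2`-kernel of `𝒱_i[K]` is conserving-diagonal through the torus images, with the canonical symbol** (the reader's `hker` for the engine's object):
`kernel 𝒱_i 2 ((k_j,σ_j),c_j) = [k̄₀ = k̄₁]·g_τ(k̄₀)`, `g_τ(Q) := kernel 𝒱_i 2 ((Q̃,σ_j),c_j)_j`. [cite: BenfattoGiulianiMastropietro2006, §2.3 (2.17)] -/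
theorem kernel_klEffectiveAction_two_eq_ite_bar (β U μ : ℝ) (K : TrigPolyC4v) (i : ℕ) (τ : Fin 2 → Fin 2 × Fin 2) (k : Fin 2 → FreqMomentum L M) :
    kernel ℂ (klEffectiveAction L M β U μ K klE0 i) 2 (fun j => ((k j, (τ j).1), (τ j).2)) =
      if ((fun _ : Fin 1 => (((k 0).1 : ℕ) : ZMod (2 * M))), (k 0).2) = (((fun _ : Fin 1 => (((k 1).1 : ℕ) : ZMod (2 * M))), (k 1).2) : TorusSite 1 (2 * M) × TorusSite 2 L)
      then (fun (τ : Fin 2 → Fin 2 × Fin 2) (Q : TorusSite 1 (2 * M) × TorusSite 2 L) =>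
          kernel ℂ (klEffectiveAction L M β U μ K klE0 i) 2 (fun j => (((⟨(Q.1 0).val, ZMod.val_lt (Q.1 0)⟩, Q.2), (τ j).1), (τ j).2))) τ
        ((fun _ : Fin 1 => (((k 0).1 : ℕ) : ZMod (2 * M))), (k 0).2) else 0 := by
  haveI : NeZero (2 * M) := ⟨by have := NeZero.ne M; omega⟩
  have hite := kernel_hubbardEffectiveActionCT_two_eq_ite L M β U μ K (klScale klE0 i) τ k
  unfold klEffectiveAction
  rw [hite]
  by_cases hk : k 0 = k 1
  · have hbar : (((fun _ : Fin 1 => (((k 0).1 : ℕ) : ZMod (2 * M))), (k 0).2) : TorusSite 1 (2 * M) × TorusSite 2 L) =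
        ((fun _ : Fin 1 => (((k 1).1 : ℕ) : ZMod (2 * M))), (k 1).2) := by rw [hk]
    rw [if_pos hk, if_pos hbar]
    simp only [freqMomentum_of_bar]
  · have hbar : (((fun _ : Fin 1 => (((k 0).1 : ℕ) : ZMod (2 * M))), (k 0).2) : TorusSite 1 (2 * M) × TorusSite 2 L) ≠
        ((fun _ : Fin 1 => (((k 1).1 : ℕ) : ZMod (2 * M))), (k 1).2) := by
      intro h
      apply hk
      rw [← freqMomentum_of_bar (k 0), ← freqMomentum_of_bar (k 1)]
      have h1 : (fun _ : Fin 1 => (((k 0).1 : ℕ) : ZMod (2 * M))) = (fun _ : Fin 1 => (((k 1).1 : ℕ) : ZMod (2 * M))) := congrArg Prod.fst h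
      have h1' : (((k 0).1 : ℕ) : ZMod (2 * M)) = (((k 1).1 : ℕ) : ZMod (2 * M)) := congrFun h1 0
      have h2 : (k 0).2 = (k 1).2 := by have := congrArg Prod.snd h; exact this
      refine Prod.ext ?_ h2
      exact Fin.ext (by rw [← val_natCast_matsubaraIdx (k 0).1, ← val_natCast_matsubaraIdx (k 1).1, h1'])
    rw [if_neg hk, if_neg hbar]

/-- The canonical symbol vanishes on the anomalous strings. [cite: BenfattoGiulianiMastropietro2006, §2.3] -/
theorem canonicalSymbol_klEffectiveAction_anomalous (β U μ : ℝ) (K : TrigPolyC4v) (i : ℕ) (τ : Fin 2 → Fin 2 × Fin 2) (hc : (τ 0).2 = (τ 1).2) :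
    (fun (τ : Fin 2 → Fin 2 × Fin 2) (Q : TorusSite 1 (2 * M) × TorusSite 2 L) =>
        kernel ℂ (klEffectiveAction L M β U μ K klE0 i) 2 (fun j => (((⟨(Q.1 0).val, ZMod.val_lt (Q.1 0)⟩, Q.2), (τ j).1), (τ j).2))) τ = 0 := by
  funext Q
  exact kernel_klEffectiveAction_two_eq_zero_of_anomalous β U μ K i τ hc _

/-! ### §2 The input-family two-leg cell of `𝒱_i[K]` — no structural hypothesis -/

/-- **THE INPUT-FAMILY TWO-LEG CELL OF THE ENGINE'S OBJECT, NO STRUCTURAL HYPOTHESIS**: for every frame `K`, coupling `U`, scales `i, J`, pin `(q, w)`,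
`klWtPinnedSumOf L M β μ K J 2 (𝒱_i[K]) q w ≤ ε_x·Σ_{ℓ′} Σ_z w_J(z)·‖Σ_Q χ̄_Q(z)•(F_{J,ω}(Q̃)·F_{J,ω′}(Q̃)·Ŵ₂^{τ(q)}(Q̃))‖`, `Ŵ₂^{τ}(Q̃) = kernel 𝒱_i 2 ((Q̃,σ_j),c_j)_j` the
diagonal two-leg kernel value on the string `τ(q)` (`(σ,c)` of the pin at leg `q`, `(σ′,c′)` of the partner at the other leg). [cite: BenfattoGiulianiMastropietro2006, §2.8 (2.76), (2.81)] -/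
theorem klWtPinnedSumOf_two_klEffectiveAction_le {β : ℝ} (hβ : 0 < β) (U μ : ℝ) (K : TrigPolyC4v) (i J : ℕ) (q : Fin 2)
    (w : SpaceTimeIdx L M × SectorLeg (sectorCount J)) :
    klWtPinnedSumOf L M β μ K J 2 (klEffectiveAction L M β U μ K klE0 i) q w ≤
      imagTimeWeight β M * ∑ ℓ' : SectorLeg (sectorCount J), ∑ z : TorusSite 1 (2 * M) × TorusSite 2 L,
        (1 + klScale klE0 J * β / (2 * M) * |(((z.1 0).valMinAbs : ℤ) : ℝ)| + klScale klE0 J * |(((z.2 0).valMinAbs : ℤ) : ℝ)| +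
            klScale klE0 J * |(((z.2 1).valMinAbs : ℤ) : ℝ)|) *
          ‖∑ Q : TorusSite 1 (2 * M) × TorusSite 2 L, (torusChar Q.1 z.1 * torusChar Q.2 z.2) •
            (klAnisoFamily L M β μ K klE0 J w.2.1.1 (⟨(Q.1 0).val, ZMod.val_lt (Q.1 0)⟩, Q.2) *
                klAnisoFamily L M β μ K klE0 J ℓ'.1.1 (⟨(Q.1 0).val, ZMod.val_lt (Q.1 0)⟩, Q.2) *
              kernel ℂ (klEffectiveAction L M β U μ K klE0 i) 2
                (fun j => (((⟨(Q.1 0).val, ZMod.val_lt (Q.1 0)⟩, Q.2), ((fun j : Fin 2 => if j = q then (w.2.1.2, w.2.2) else (ℓ'.1.2, ℓ'.2)) j).1),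
                  ((fun j : Fin 2 => if j = q then (w.2.1.2, w.2.2) else (ℓ'.1.2, ℓ'.2)) j).2)))‖ :=
  klWtPinnedSumOf_two_le_sum_momentWt_charSum hβ μ K J (klEffectiveAction L M β U μ K klE0 i)
    (fun (τ : Fin 2 → Fin 2 × Fin 2) (Q : TorusSite 1 (2 * M) × TorusSite 2 L) =>
      kernel ℂ (klEffectiveAction L M β U μ K klE0 i) 2 (fun j => (((⟨(Q.1 0).val, ZMod.val_lt (Q.1 0)⟩, Q.2), (τ j).1), (τ j).2)))
    (kernel_klEffectiveAction_two_eq_ite_bar β U μ K i) (canonicalSymbol_klEffectiveAction_anomalous β U μ K i) q w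

/-- **(E2) FROM ORDER-THREE DATA OF THE ACTUAL TWO-LEG SYMBOL** — the E1-facing face of the input-family two-leg cell of `𝒱_i[K]`, no structural hypothesis:
at family `F_J`, weight rates `s₀ = Λ_Jβ/(2M)`, `s₁ = Λ_J`, frame rates `s₂, s₃` on an integer frame `(v⊥, v)`, near radius `R₀`; per partner label `ℓ′` the support
count `N_s(ℓ′)` of `F_{J,ω}F_{J,ω′}`, the sup `A₀(ℓ′)` of the pair symbol `1·((F_{J,ω}F_{J,ω′})·Ŵ₂^{τ(q)})` and its third single-direction differences in the five
directions ⟹ `klWtPinnedSumOf L M β μ K J 2 (𝒱_i[K]) q w ≤ ε_x·Σ_{ℓ′} √(…)·√(21·2M·L²·N_s(ℓ′))·A₀(ℓ′)` (p3's `sliceCharSumWt_l1_le_of_data` pair by pair).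
[cite: BenfattoGiulianiMastropietro2006, Lemma 2.2 (2.52), §2.8 (2.76), (2.81)] -/
theorem klWtPinnedSumOf_two_klEffectiveAction_le_of_symbolData {β : ℝ} (hβ : 0 < β) (U μ : ℝ) (K : TrigPolyC4v) (i J : ℕ) (q : Fin 2)
    (w : SpaceTimeIdx L M × SectorLeg (sectorCount J))
    (v : Fin 2 → ℤ) (hv : v ≠ 0) {s₂ s₃ : ℝ} (hs₂ : 0 < s₂) (hs₃ : 0 < s₃) {R₀ : ℕ} (hR₀ : 2 * (|v 0| + |v 1|) * (R₀ : ℤ) < L)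
    (Ns : SectorLeg (sectorCount J) → ℕ) (A₀ : SectorLeg (sectorCount J) → ℝ) (hA₀ : ∀ ℓ', 0 ≤ A₀ ℓ')
    (hsupp : ∀ ℓ' : SectorLeg (sectorCount J), (univ.filter fun Q : TorusSite 1 (2 * M) × TorusSite 2 L =>
        klAnisoFamily L M β μ K klE0 J w.2.1.1 (⟨(Q.1 0).val, ZMod.val_lt (Q.1 0)⟩, Q.2) *
          klAnisoFamily L M β μ K klE0 J ℓ'.1.1 (⟨(Q.1 0).val, ZMod.val_lt (Q.1 0)⟩, Q.2) ≠ 0).card ≤ Ns ℓ')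
    (hsup : ∀ (ℓ' : SectorLeg (sectorCount J)) (Q : TorusSite 1 (2 * M) × TorusSite 2 L),
      ‖(1 : ℂ) * (klAnisoFamily L M β μ K klE0 J w.2.1.1 (⟨(Q.1 0).val, ZMod.val_lt (Q.1 0)⟩, Q.2) *
          klAnisoFamily L M β μ K klE0 J ℓ'.1.1 (⟨(Q.1 0).val, ZMod.val_lt (Q.1 0)⟩, Q.2) *
        kernel ℂ (klEffectiveAction L M β U μ K klE0 i) 2
                (fun j => (((⟨(Q.1 0).val, ZMod.val_lt (Q.1 0)⟩, Q.2), ((fun j : Fin 2 => if j = q then (w.2.1.2, w.2.2) else (ℓ'.1.2, ℓ'.2)) j).1),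
                  ((fun j : Fin 2 => if j = q then (w.2.1.2, w.2.2) else (ℓ'.1.2, ℓ'.2)) j).2)))‖ ≤ A₀ ℓ')
    (h₀ : ∀ (ℓ' : SectorLeg (sectorCount J)) (Q : TorusSite 1 (2 * M) × TorusSite 2 L),
      ‖(fwdDiff ((fun _ : Fin 1 => (1 : ZMod (2 * M))), (0 : TorusSite 2 L)))^[3]
        (fun y : TorusSite 1 (2 * M) × TorusSite 2 L => (1 : ℂ) * (klAnisoFamily L M β μ K klE0 J w.2.1.1 (⟨(y.1 0).val, ZMod.val_lt (y.1 0)⟩, y.2) *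
          klAnisoFamily L M β μ K klE0 J ℓ'.1.1 (⟨(y.1 0).val, ZMod.val_lt (y.1 0)⟩, y.2) *
          kernel ℂ (klEffectiveAction L M β U μ K klE0 i) 2
                (fun j => (((⟨(y.1 0).val, ZMod.val_lt (y.1 0)⟩, y.2), ((fun j : Fin 2 => if j = q then (w.2.1.2, w.2.2) else (ℓ'.1.2, ℓ'.2)) j).1),
                  ((fun j : Fin 2 => if j = q then (w.2.1.2, w.2.2) else (ℓ'.1.2, ℓ'.2)) j).2)))) Q‖ ≤ A₀ ℓ' * (4 / (klScale klE0 J * β)) ^ 3)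
    (h₁ : ∀ (ℓ' : SectorLeg (sectorCount J)) (Q : TorusSite 1 (2 * M) × TorusSite 2 L) (e : Fin 2),
      ‖(fwdDiff ((0 : TorusSite 1 (2 * M)), (Pi.single e (1 : ZMod L) : TorusSite 2 L)))^[3]
        (fun y : TorusSite 1 (2 * M) × TorusSite 2 L => (1 : ℂ) * (klAnisoFamily L M β μ K klE0 J w.2.1.1 (⟨(y.1 0).val, ZMod.val_lt (y.1 0)⟩, y.2) *
          klAnisoFamily L M β μ K klE0 J ℓ'.1.1 (⟨(y.1 0).val, ZMod.val_lt (y.1 0)⟩, y.2) *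
          kernel ℂ (klEffectiveAction L M β U μ K klE0 i) 2
                (fun j => (((⟨(y.1 0).val, ZMod.val_lt (y.1 0)⟩, y.2), ((fun j : Fin 2 => if j = q then (w.2.1.2, w.2.2) else (ℓ'.1.2, ℓ'.2)) j).1),
                  ((fun j : Fin 2 => if j = q then (w.2.1.2, w.2.2) else (ℓ'.1.2, ℓ'.2)) j).2)))) Q‖ ≤ A₀ ℓ' * (4 / (klScale klE0 J * L)) ^ 3)
    (h₂ : ∀ (ℓ' : SectorLeg (sectorCount J)) (Q : TorusSite 1 (2 * M) × TorusSite 2 L),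
      ‖(fwdDiff ((0 : TorusSite 1 (2 * M)), (fun j => ((![-v 1, v 0] j : ℤ) : ZMod L))))^[3]
        (fun y : TorusSite 1 (2 * M) × TorusSite 2 L => (1 : ℂ) * (klAnisoFamily L M β μ K klE0 J w.2.1.1 (⟨(y.1 0).val, ZMod.val_lt (y.1 0)⟩, y.2) *
          klAnisoFamily L M β μ K klE0 J ℓ'.1.1 (⟨(y.1 0).val, ZMod.val_lt (y.1 0)⟩, y.2) *
          kernel ℂ (klEffectiveAction L M β U μ K klE0 i) 2
                (fun j => (((⟨(y.1 0).val, ZMod.val_lt (y.1 0)⟩, y.2), ((fun j : Fin 2 => if j = q then (w.2.1.2, w.2.2) else (ℓ'.1.2, ℓ'.2)) j).1),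
                  ((fun j : Fin 2 => if j = q then (w.2.1.2, w.2.2) else (ℓ'.1.2, ℓ'.2)) j).2)))) Q‖ ≤ A₀ ℓ' * (4 / (s₂ * L)) ^ 3)
    (h₃ : ∀ (ℓ' : SectorLeg (sectorCount J)) (Q : TorusSite 1 (2 * M) × TorusSite 2 L),
      ‖(fwdDiff ((0 : TorusSite 1 (2 * M)), (fun j => ((v j : ℤ) : ZMod L))))^[3]
        (fun y : TorusSite 1 (2 * M) × TorusSite 2 L => (1 : ℂ) * (klAnisoFamily L M β μ K klE0 J w.2.1.1 (⟨(y.1 0).val, ZMod.val_lt (y.1 0)⟩, y.2) *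
          klAnisoFamily L M β μ K klE0 J ℓ'.1.1 (⟨(y.1 0).val, ZMod.val_lt (y.1 0)⟩, y.2) *
          kernel ℂ (klEffectiveAction L M β U μ K klE0 i) 2
                (fun j => (((⟨(y.1 0).val, ZMod.val_lt (y.1 0)⟩, y.2), ((fun j : Fin 2 => if j = q then (w.2.1.2, w.2.2) else (ℓ'.1.2, ℓ'.2)) j).1),
                  ((fun j : Fin 2 => if j = q then (w.2.1.2, w.2.2) else (ℓ'.1.2, ℓ'.2)) j).2)))) Q‖ ≤ A₀ ℓ' * (4 / (s₃ * L)) ^ 3) :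
    klWtPinnedSumOf L M β μ K J 2 (klEffectiveAction L M β U μ K klE0 i) q w ≤
      imagTimeWeight β M * ∑ ℓ' : SectorLeg (sectorCount J),
        Real.sqrt (32768 * (1 / (klScale klE0 J * β / (2 * M)) + 1) *
            ((1 + 2 * Real.sqrt 2 * klScale klE0 J / (s₂ * Real.sqrt ((v 0 : ℝ) ^ 2 + (v 1 : ℝ) ^ 2)) +
                2 * Real.sqrt 2 * klScale klE0 J / (s₃ * Real.sqrt ((v 0 : ℝ) ^ 2 + (v 1 : ℝ) ^ 2))) ^ 2 *
              (4 * ((2 * Real.sqrt 2 / (s₂ * Real.sqrt ((v 0 : ℝ) ^ 2 + (v 1 : ℝ) ^ 2)) + 2) *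
                (2 * Real.sqrt 2 / (s₃ * Real.sqrt ((v 0 : ℝ) ^ 2 + (v 1 : ℝ) ^ 2)) + 2)))
              + 16 * (1 / klScale klE0 J + 1) ^ 2 / (1 + klScale klE0 J * R₀))) *
          Real.sqrt (21 * ((2 * M : ℕ) : ℝ) * (L : ℝ) ^ 2 * Ns ℓ') * A₀ ℓ' := by
  haveI : NeZero (2 * M) := ⟨by have := NeZero.ne M; omega⟩
  have hΛ : 0 < klScale klE0 J := klth_klScale_pos J
  have hM0 : (0 : ℝ) < M := by exact_mod_cast Nat.pos_of_ne_zero (NeZero.ne M)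
  have hs₀ : 0 < klScale klE0 J * β / (2 * M) := by positivity
  have hP : klScale klE0 J * β / (2 * M) * ((2 * M : ℕ) : ℝ) = klScale klE0 J * β := by
    push_cast; field_simp
  refine (klWtPinnedSumOf_two_klEffectiveAction_le hβ U μ K i J q w).trans
    (mul_le_mul_of_nonneg_left (Finset.sum_le_sum fun ℓ' _ => ?_) (imagTimeWeight_nonneg hβ.le M))
  have h := sliceCharSumWt_l1_le_of_data (1 : ℂ)
    (fun Q : TorusSite 1 (2 * M) × TorusSite 2 L => klAnisoFamily L M β μ K klE0 J w.2.1.1 (⟨(Q.1 0).val, ZMod.val_lt (Q.1 0)⟩, Q.2) *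
          klAnisoFamily L M β μ K klE0 J ℓ'.1.1 (⟨(Q.1 0).val, ZMod.val_lt (Q.1 0)⟩, Q.2))
    (fun Q : TorusSite 1 (2 * M) × TorusSite 2 L => kernel ℂ (klEffectiveAction L M β U μ K klE0 i) 2
                (fun j => (((⟨(Q.1 0).val, ZMod.val_lt (Q.1 0)⟩, Q.2), ((fun j : Fin 2 => if j = q then (w.2.1.2, w.2.2) else (ℓ'.1.2, ℓ'.2)) j).1),
                  ((fun j : Fin 2 => if j = q then (w.2.1.2, w.2.2) else (ℓ'.1.2, ℓ'.2)) j).2))) v hv hs₀ hΛ hs₂ hs₃ hR₀ (hA₀ ℓ') (hsupp ℓ') (hsup ℓ')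
    (fun Q => by rw [hP]; exact h₀ ℓ' Q) (h₁ ℓ') (h₂ ℓ') (h₃ ℓ')
  simpa only [one_mul] using h

end Summit.HubbardSuperconductivity.HubbardSuperconductivity.Theorems.TorusFourierL2

end
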